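import Literature.Computability.QuantumComplexity.AKSMachinePow
import Literature.Computability.Complexity.IndexAllBricks
import Literature.Computability.Cryptography.ShorPerfectPowerFP
import Literature.NumberTheory.Primality.AKSAlgorithm
import HarnessLib

/-!
# The AKS machine, III: steps 1–4 of the test as `FP` string functions (AKS 2004, §4)

Continuation of `AKSMachinePow.lean`, towards the assembly of `AKS.aksDecide`
(`Literature/NumberTheory/Primality/AKSAlgorithm.lean`, [AKS04, §4]) in the `FP` string algebra
(`AKSMachine.lean`). All steps read the **padded input** `U = mkU w = ⟨1^{rBound L (L+1)}, w⟩`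
(`L = |w|`; on a canonical numeral `U = uOf n`), whose padding is the yardstick of every loop:

* `noFactorFn` — step 3 of [AKS04] (trial division): `[¬ AKS.HasFactorLe n R]`, a bounded
  conjunction `Brick.allIdxFn` (`IndexAllBricks.lean`) of the one-bit tests `noFacTest`;
* `nLeRFn` — step 4: `[n ≤ R]`;
* `ppBitFn` — step 1 (perfect powers): `[AKS.IsPerfectPower n]`, read off Shor's classical
  perfect-power detector `ShorFP.ppF` (`Cryptography/ShorPerfectPowerFP.lean`; `ppBase n < n`,
  `isPerfectPower_iff_ppBase_lt`);
* `rFn` — step 2: `bin (AKS.leastR n L R)`, the first `j ≤ R` with `2 ≤ j ∧ GoodR n L j`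
  (`GoodGe2`), by the "first success" fold `firstOp` (`foldAcc_firstOp`) of the pieces `pieceR`,
  each testing `GoodR` with an `allIdxFn` of `modExpFn` tests (`goodTest`, `goodFn`).

Each function comes with `_mem_FP` and its value on `uOf n` (`_apply`).

## References

* [AKS04] M. Agrawal, N. Kayal, N. Saxena, *PRIMES is in P*, Ann. of Math. 160 (2004) 781–793,
  §4 (the algorithm, steps 1–4), Thm 5.1.
* S. Arora, B. Barak, *Computational Complexity: A Modern Approach*, CUP 2009, §1.3.
-/

namespace Literature.Computability.QuantumComplexity

open _root_.Computability Complexity Complexity.Brick Polynomial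
open Literature.NumberTheory.Primality Literature.Computability.Cryptography

namespace AKSMachine

/-! ### The padded input record `U = ⟨pad, w⟩` -/

/-- The padding polynomial `(2L⁵ + 8)(L + 1) = rBound L · (L + 1)`. [folklore] -/
noncomputable def padPoly : Polynomial ℕ := (2 * X ^ 5 + 8) * (X + 1)

/-- The polynomial `2L⁵ + 9 = rBound L + 1` (number of trial divisors / order candidates). [folklore] -/
noncomputable def rPoly1 : Polynomial ℕ := 2 * X ^ 5 + 9

/-- `padPoly_eval` (auxiliary; see the module docstring). [folklore] -/
@[simp] theorem padPoly_eval (L : ℕ) : padPoly.eval L = AKS.rBound L * (L + 1) := by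
  simp [padPoly, AKS.rBound]

/-- `rPoly1_eval` (auxiliary; see the module docstring). [folklore] -/
@[simp] theorem rPoly1_eval (L : ℕ) : rPoly1.eval L = AKS.rBound L + 1 := by
  simp [rPoly1, AKS.rBound]

/-- `L² + 1 ≤ rBound L`. [folklore] -/
theorem sq_succ_le_rBound (L : ℕ) : L ^ 2 + 1 ≤ AKS.rBound L := by
  unfold AKS.rBound
  rcases Nat.lt_or_ge L 2 with h | h
  · interval_cases L <;> norm_num
  · have : L ^ 2 ≤ L ^ 5 := Nat.pow_le_pow_right (by omega) (by norm_num)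
    omega

/-- **The padded input** `mkU w = ⟨1^{rBound |w| (|w| + 1)}, w⟩`. [folklore] -/
noncomputable def mkU : List Bool → List Bool := fanoutFn (Plumb.polyFn padPoly) id

/-- `mkU` is in `FP` (composition of bricks). [folklore] -/
theorem mkU_mem_FP : mkU ∈ FP := fanoutFn_mem_FP (Plumb.polyFn_mem_FP _) OracleCompose.id_mem_FP

/-- The padded input of a canonical numeral. [folklore] -/
def uOf (n : ℕ) : List Bool := boolPair (ones (AKS.rBound n.size * (n.size + 1))) (encodeNat n)

/-- `mkU_encodeNat` (auxiliary; see the module docstring). [folklore] -/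
theorem mkU_encodeNat (n : ℕ) : mkU (encodeNat n) = uOf n := by
  simp [mkU, uOf, TM2Pass.length_encodeNat_eq_size]

/-- `|uOf n| = 2 rBound L (L + 1) + L + 2`. [folklore] -/
theorem length_uOf (n : ℕ) :
    (uOf n).length = 2 * (AKS.rBound n.size * (n.size + 1)) + n.size + 2 := by
  rw [uOf, length_boolPair, List.length_replicate, TM2Pass.length_encodeNat_eq_size]; omega

/-- `rBound L + 1 ≤ |uOf n|`. [folklore] -/
theorem rBound_succ_le_length_uOf (n : ℕ) : AKS.rBound n.size + 1 ≤ (uOf n).length := by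
  rw [length_uOf]; have : 1 ≤ n.size + 1 := by omega
  nlinarith [Nat.zero_le n.size]

/-! ### Step 3 (trial division) and step 4 -/

/-- On `⟨U, 1ᵈ⟩`: the bit `[¬ (2 ≤ d ∧ d < n ∧ d ∣ n)]`. [cite: AgrawalKayalSaxena2004, §4 (step 3)] -/
noncomputable def noFacTest : List Bool → List Bool :=
  notFn (andFn (valGeTwoFn ∘ lenBinF ∘ sndF)
    (andFn (ltFn ∘ fanoutFn (lenBinF ∘ sndF) (sndF ∘ fstF))
      (isNilFn ∘ remFn ∘ fanoutFn (sndF ∘ fstF) (lenBinF ∘ sndF))))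

/-- `noFacTest` is in `FP` (composition of bricks). [folklore] -/
theorem noFacTest_mem_FP : noFacTest ∈ FP :=
  notFn_mem_FP (andFn_mem_FP (comp_mem_FP valGeTwoFn_mem_FP (comp_mem_FP lenBinF_mem_FP sndF_mem_FP))
    (andFn_mem_FP (comp_mem_FP ltFn_mem_FP (fanoutFn_mem_FP (comp_mem_FP lenBinF_mem_FP sndF_mem_FP) (comp_mem_FP sndF_mem_FP fstF_mem_FP)))
      (comp_mem_FP isNilFn_mem_FP (comp_mem_FP remFn_mem_FP
        (fanoutFn_mem_FP (comp_mem_FP sndF_mem_FP fstF_mem_FP) (comp_mem_FP lenBinF_mem_FP sndF_mem_FP))))))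

/-- `oneBit_noFacTest` (auxiliary; see the module docstring). [folklore] -/
theorem oneBit_noFacTest : OneBit noFacTest :=
  oneBit_notFn (oneBit_andFn (oneBit_valGeTwoFn.comp _) (oneBit_andFn (oneBit_ltFn.comp _) (oneBit_isNilFn.comp _)))

/-- Value of the trial-division test. [folklore] -/
theorem noFacTest_apply (pad : List Bool) (n d : ℕ) :
    noFacTest (boolPair (boolPair pad (encodeNat n)) (ones d)) = [!decide (2 ≤ d ∧ d < n ∧ d ∣ n)] := by
  have h1 : (valGeTwoFn ∘ lenBinF ∘ sndF) (boolPair (boolPair pad (encodeNat n)) (ones d)) = [decide (2 ≤ d)] := by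
    simp [valGeTwoFn]
  have h2 : (ltFn ∘ fanoutFn (lenBinF ∘ sndF) (sndF ∘ fstF)) (boolPair (boolPair pad (encodeNat n)) (ones d)) = [decide (d < n)] := by
    simp
  have h3 : (isNilFn ∘ remFn ∘ fanoutFn (sndF ∘ fstF) (lenBinF ∘ sndF)) (boolPair (boolPair pad (encodeNat n)) (ones d)) =
      [decide (d ∣ n)] := by
    simp only [Function.comp_apply, fanoutFn_apply, sndF_boolPair, fstF_boolPair, lenBinF_apply, List.length_replicate,
      remFn_boolPair, bitsToNat_encodeNat, isNilFn, List.cons.injEq, and_true]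
    exact decide_eq_decide.mpr ⟨fun h => Nat.dvd_of_mod_eq_zero (by simpa using congrArg bitsToNat h),
      fun h => by rw [Nat.mod_eq_zero_of_dvd h]; rfl⟩
  rw [noFacTest, notFn_apply (andFn_apply h1 (andFn_apply h2 h3))]
  simp [Bool.decide_and]

/-- **Step 3**: `noFactorFn U = [∀ d ≤ R, ¬ (2 ≤ d < n ∧ d ∣ n)]`. [cite: AgrawalKayalSaxena2004, §4 (step 3)] -/
noncomputable def noFactorFn : List Bool → List Bool := allIdxFn (Plumb.polyFn rPoly1 ∘ sndF) noFacTest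

/-- `noFactorFn` is in `FP` (composition of bricks). [folklore] -/
theorem noFactorFn_mem_FP : noFactorFn ∈ FP :=
  allIdxFn_mem_FP (comp_mem_FP (Plumb.polyFn_mem_FP _) sndF_mem_FP) noFacTest_mem_FP oneBit_noFacTest

/-- `noFactorFn_apply` (auxiliary; see the module docstring). [folklore] -/
theorem noFactorFn_apply (n : ℕ) : noFactorFn (uOf n) = [decide (¬AKS.HasFactorLe n (AKS.rBound n.size))] := by
  have hh : ((Plumb.polyFn rPoly1 ∘ sndF) (uOf n)).length = AKS.rBound n.size + 1 := by
    simp [uOf, TM2Pass.length_encodeNat_eq_size]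
  rw [noFactorFn, allIdxFn_apply oneBit_noFacTest (by rw [hh]; exact rBound_succ_le_length_uOf n), hh]
  simp only [uOf, noFacTest_apply, List.cons.injEq, and_true, Bool.not_eq_true', decide_eq_false_iff_not]
  refine decide_eq_decide.mpr ⟨fun h ⟨d, hd, hdn, hdvd⟩ => ?_, fun h d hd hP => h ⟨d, Finset.mem_Icc.mpr ⟨hP.1, by omega⟩, hP.2⟩⟩
  exact h d (by have := (Finset.mem_Icc.mp hd).2; omega) ⟨(Finset.mem_Icc.mp hd).1, hdn, hdvd⟩

/-- **Step 4**: `nLeRFn U = [n ≤ R]`. [cite: AgrawalKayalSaxena2004, §4 (step 4)] -/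
noncomputable def nLeRFn : List Bool → List Bool := ltFn ∘ fanoutFn sndF (lenBinF ∘ Plumb.polyFn rPoly1 ∘ sndF)

/-- `nLeRFn` is in `FP` (composition of bricks). [folklore] -/
theorem nLeRFn_mem_FP : nLeRFn ∈ FP :=
  comp_mem_FP ltFn_mem_FP (fanoutFn_mem_FP sndF_mem_FP (comp_mem_FP lenBinF_mem_FP (comp_mem_FP (Plumb.polyFn_mem_FP _) sndF_mem_FP)))

/-- `oneBit_nLeRFn` (auxiliary; see the module docstring). [folklore] -/
theorem oneBit_nLeRFn : OneBit nLeRFn := oneBit_ltFn.comp _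

/-- `nLeRFn_apply` (auxiliary; see the module docstring). [folklore] -/
theorem nLeRFn_apply (n : ℕ) : nLeRFn (uOf n) = [decide (n ≤ AKS.rBound n.size)] := by
  simp only [nLeRFn, Function.comp_apply, fanoutFn_apply, uOf, sndF_boolPair, Plumb.polyFn_apply, lenBinF_apply,
    List.length_replicate, TM2Pass.length_encodeNat_eq_size, rPoly1_eval, ltFn_boolPair, bitsToNat_encodeNat]
  simp

/-! ### Step 1 (perfect powers), by Shor's classical perfect-power detector -/

/-- **Step 1**: the perfect-power bit `fstF (ppF w) = [ppBase n < n]`. [cite: AgrawalKayalSaxena2004, §4 (step 1)] -/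
noncomputable def ppBitFn : List Bool → List Bool := fstF ∘ ShorFP.ppF ∘ sndF

/-- `ppBitFn` is in `FP` (composition of bricks). [folklore] -/
theorem ppBitFn_mem_FP : ppBitFn ∈ FP := comp_mem_FP fstF_mem_FP (comp_mem_FP ShorFP.ppF_mem_FP sndF_mem_FP)

/-- `oneBit_ppBitFn` (auxiliary; see the module docstring). [folklore] -/
theorem oneBit_ppBitFn : OneBit ppBitFn := fun w => ShorFP.oneBit_fstF_ppF (sndF w)

/-- For `n ≥ 2`: `n` is a perfect power iff Shor's least root `ppBase n` is `< n`. [folklore] -/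
theorem isPerfectPower_iff_ppBase_lt {n : ℕ} (hn : 2 ≤ n) : AKS.IsPerfectPower n ↔ Shor1997.ppBase n < n := by
  rw [AKS.isPerfectPower_iff hn]
  constructor
  · rintro ⟨a, b, hb, hab⟩
    have ha : 2 ≤ a := by
      by_contra h
      have : a ^ b ≤ 1 := by
        calc a ^ b ≤ 1 ^ b := Nat.pow_le_pow_left (by omega) b
          _ = 1 := one_pow b
      omega
    calc Shor1997.ppBase n ≤ a := Shor1997.ppBase_le_of_pow_eq (by omega) (by omega) hab
      _ < a ^ 2 := by nlinarith
      _ ≤ a ^ b := Nat.pow_le_pow_right (by omega) hb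
      _ = n := hab
  · intro hlt
    obtain ⟨k, hk, h⟩ := Shor1997.ppBase_spec n
    refine ⟨Shor1997.ppBase n, k, ?_, h⟩
    by_contra hk2
    have : k = 1 := by omega
    rw [this, pow_one] at h
    omega

/-- `ppBitFn_apply` (auxiliary; see the module docstring). [folklore] -/
theorem ppBitFn_apply {n : ℕ} (hn : 2 ≤ n) : ppBitFn (uOf n) = [decide (AKS.IsPerfectPower n)] := by
  rw [ppBitFn, Function.comp_apply, Function.comp_apply, uOf, sndF_boolPair, ShorFP.ppF_encodeNat hn, fstF_boolPair]
  simp [isPerfectPower_iff_ppBase_lt hn]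

/-! ### Step 2: the least `r` with `n ^ k mod r ≠ 1`, `1 ≤ k ≤ L²` -/

/-- On `⟨⟨U, 1ʲ⟩, 1ᵏ⟩`: the bit `[k = 0 ∨ n ^ k mod j ≠ 1]`. [cite: AgrawalKayalSaxena2004, §4 (step 2)] -/
noncomputable def goodTest : List Bool → List Bool :=
  orFn (isNilFn ∘ sndF)
    (notFn (eqValFn ∘ fanoutFn
      (modExpFn ∘ fanoutFn (sndF ∘ fstF ∘ fstF) (fanoutFn (lenBinF ∘ sndF) (lenBinF ∘ sndF ∘ fstF)))
      fun _ => encodeNat 1))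

/-- `goodTest` is in `FP` (composition of bricks). [folklore] -/
theorem goodTest_mem_FP : goodTest ∈ FP :=
  orFn_mem_FP (comp_mem_FP isNilFn_mem_FP sndF_mem_FP)
    (notFn_mem_FP (comp_mem_FP eqValFn_mem_FP (fanoutFn_mem_FP
      (comp_mem_FP modExpFn_mem_FP (fanoutFn_mem_FP (comp_mem_FP sndF_mem_FP (comp_mem_FP fstF_mem_FP fstF_mem_FP))
        (fanoutFn_mem_FP (comp_mem_FP lenBinF_mem_FP sndF_mem_FP) (comp_mem_FP lenBinF_mem_FP (comp_mem_FP sndF_mem_FP fstF_mem_FP)))))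
      (const_mem_FP _))))

/-- `oneBit_goodTest` (auxiliary; see the module docstring). [folklore] -/
theorem oneBit_goodTest : OneBit goodTest :=
  oneBit_orFn (oneBit_isNilFn.comp _) (oneBit_notFn (oneBit_eqValFn.comp _))

/-- `goodTest_apply` (auxiliary; see the module docstring). [folklore] -/
theorem goodTest_apply (pad : List Bool) (n : ℕ) {j : ℕ} (hj : 2 ≤ j) (k : ℕ) :
    goodTest (boolPair (boolPair (boolPair pad (encodeNat n)) (ones j)) (ones k)) = [decide (k = 0 ∨ n ^ k % j ≠ 1)] := by
  have h1 : (isNilFn ∘ sndF) (boolPair (boolPair (boolPair pad (encodeNat n)) (ones j)) (ones k)) = [decide (k = 0)] := by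
    cases k <;> simp [isNilFn, List.replicate_succ]
  have h2 : (eqValFn ∘ fanoutFn (modExpFn ∘ fanoutFn (sndF ∘ fstF ∘ fstF) (fanoutFn (lenBinF ∘ sndF) (lenBinF ∘ sndF ∘ fstF)))
      fun _ => encodeNat 1) (boolPair (boolPair (boolPair pad (encodeNat n)) (ones j)) (ones k)) = [decide (n ^ k % j = 1)] := by
    simp only [Function.comp_apply, fanoutFn_apply, sndF_boolPair, fstF_boolPair, lenBinF_apply, List.length_replicate]
    rw [modExpFn_boolPair (by simpa using hj), eqValFn_boolPair]
    simp
  rw [goodTest, orFn_apply h1 (notFn_apply h2)]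
  by_cases hk : k = 0 <;> by_cases hm : n ^ k % j = 1 <;> simp [hk, hm]

/-- On `V = ⟨U, 1ʲ⟩`: the bit `[∀ k ≤ L², k = 0 ∨ n ^ k mod j ≠ 1] = [GoodR n L j]` (`j ≥ 2`). [cite: AgrawalKayalSaxena2004, §4 (step 2)] -/
noncomputable def goodFn : List Bool → List Bool := allIdxFn (Plumb.polyFn (X ^ 2 + 1) ∘ sndF ∘ fstF) goodTest

/-- `goodFn` is in `FP` (composition of bricks). [folklore] -/
theorem goodFn_mem_FP : goodFn ∈ FP :=
  allIdxFn_mem_FP (comp_mem_FP (Plumb.polyFn_mem_FP _) (comp_mem_FP sndF_mem_FP fstF_mem_FP)) goodTest_mem_FP oneBit_goodTest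

/-- The yardstick of `goodFn` fits. [folklore] -/
theorem goodFn_len (n j : ℕ) :
    ((Plumb.polyFn (X ^ 2 + 1) ∘ sndF ∘ fstF) (boolPair (uOf n) (ones j))).length ≤ (boolPair (uOf n) (ones j)).length := by
  simp only [Function.comp_apply, fstF_boolPair, uOf, sndF_boolPair, Plumb.polyFn_apply, TM2Pass.length_encodeNat_eq_size,
    eval_add, eval_pow, eval_X, eval_one, List.length_replicate, length_boolPair]
  have := sq_succ_le_rBound n.size
  nlinarith [Nat.zero_le (AKS.rBound n.size)]

/-- `goodFn_apply` (auxiliary; see the module docstring). [folklore] -/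
theorem goodFn_apply (n : ℕ) {j : ℕ} (hj : 2 ≤ j) : goodFn (boolPair (uOf n) (ones j)) = [decide (AKS.GoodR n n.size j)] := by
  have hh : ((Plumb.polyFn (X ^ 2 + 1) ∘ sndF ∘ fstF) (boolPair (uOf n) (ones j))).length = n.size ^ 2 + 1 := by
    simp [uOf, TM2Pass.length_encodeNat_eq_size]
  rw [goodFn, allIdxFn_apply oneBit_goodTest (goodFn_len n j), hh]
  simp only [uOf, goodTest_apply _ n hj, List.cons.injEq, and_true, decide_eq_true_eq]
  refine decide_eq_decide.mpr ⟨fun h k hk => ?_, fun h k hk => ?_⟩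
  · have hk' := Finset.mem_Icc.mp hk
    exact (h k (by omega)).resolve_left (by omega)
  · rcases Nat.eq_zero_or_pos k with rfl | hk0
    · exact Or.inl rfl
    · exact Or.inr (h k (Finset.mem_Icc.mpr ⟨hk0, by omega⟩))

/-- On `⟨U, 1ʲ⟩`: `bin j` if `j ≥ 2` and `GoodR n L j`, else `ε`. [cite: AgrawalKayalSaxena2004, §4 (step 2)] -/
noncomputable def pieceR : List Bool → List Bool :=
  iteFn (andFn (valGeTwoFn ∘ lenBinF ∘ sndF) goodFn) (lenBinF ∘ sndF) fun _ => []

/-- `pieceR` is in `FP` (composition of bricks). [folklore] -/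
theorem pieceR_mem_FP : pieceR ∈ FP :=
  iteFn_mem_FP (andFn_mem_FP (comp_mem_FP valGeTwoFn_mem_FP (comp_mem_FP lenBinF_mem_FP sndF_mem_FP)) goodFn_mem_FP)
    (comp_mem_FP lenBinF_mem_FP sndF_mem_FP) (const_mem_FP _)

/-- The predicate selected by `pieceR`. [folklore] -/
def GoodGe2 (n L j : ℕ) : Prop := 2 ≤ j ∧ AKS.GoodR n L j

/-- Decidability instance. [folklore] -/
instance (n L j : ℕ) : Decidable (GoodGe2 n L j) := by unfold GoodGe2; infer_instance

/-- `pieceR_apply` (auxiliary; see the module docstring). [folklore] -/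
theorem pieceR_apply (n j : ℕ) : pieceR (boolPair (uOf n) (ones j)) = if GoodGe2 n n.size j then encodeNat j else [] := by
  have h1 : (valGeTwoFn ∘ lenBinF ∘ sndF) (boolPair (uOf n) (ones j)) = [decide (2 ≤ j)] := by simp [valGeTwoFn]
  have hbit : andFn (valGeTwoFn ∘ lenBinF ∘ sndF) goodFn (boolPair (uOf n) (ones j)) = [decide (GoodGe2 n n.size j)] := by
    by_cases hj : 2 ≤ j
    · rw [andFn_apply h1 (goodFn_apply n hj)]; simp [GoodGe2, hj]
    · obtain ⟨b, hb⟩ : ∃ b, goodFn (boolPair (uOf n) (ones j)) = [b] :=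
        ⟨_, by rw [goodFn, allIdxFn_apply oneBit_goodTest (goodFn_len n j)]⟩
      rw [andFn_apply h1 hb]; simp [GoodGe2, hj]
  rw [pieceR, iteFn_apply hbit]
  by_cases h : GoodGe2 n n.size j <;> simp [h]

/-- **The "first success" fold operation**: keep a nonempty accumulator, else take the piece. [folklore] -/
noncomputable def firstOp : List Bool → List Bool := iteFn (isNilFn ∘ fstF) sndF fstF

/-- `firstOp` is in `FP` (composition of bricks). [folklore] -/
theorem firstOp_mem_FP : firstOp ∈ FP := iteFn_mem_FP (comp_mem_FP isNilFn_mem_FP fstF_mem_FP) sndF_mem_FP fstF_mem_FP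

/-- `firstOp_boolPair` (auxiliary; see the module docstring). [folklore] -/
@[simp] theorem firstOp_boolPair (a b : List Bool) : firstOp (boolPair a b) = if a = [] then b else a := by
  rw [firstOp, iteFn_apply (b := decide (a = []))] <;> by_cases h : a = [] <;> simp [h, isNilFn]

/-- `length_firstOp_le` (auxiliary; see the module docstring). [folklore] -/
theorem length_firstOp_le (w : List Bool) : (firstOp w).length ≤ (fstF w).length + (sndF w).length + 0 := by
  rw [firstOp, iteFn_of_oneBit (oneBit_isNilFn.comp _)]
  split_ifs <;> simp

/-- A nonempty accumulator is kept by the first-success fold. [folklore] -/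
theorem foldAcc_firstOp_kept (f : List Bool → List Bool) (x : List Bool) :
    ∀ (m i : ℕ) (acc : List Bool), acc ≠ [] → foldAcc firstOp f x i m acc = acc
  | 0, _, _, _ => rfl
  | m + 1, i, acc, hacc => by rw [foldAcc_succ, firstOp_boolPair, if_neg hacc, foldAcc_firstOp_kept f x m (i + 1) acc hacc]

/-- The first-success fold from the empty accumulator returns the first nonempty piece. [folklore] -/
theorem foldAcc_firstOp (f : List Bool → List Bool) (x : List Bool) :
    ∀ (j₀ i k : ℕ), j₀ < k → (∀ j < j₀, f (boolPair x (ones (i + j))) = []) → f (boolPair x (ones (i + j₀))) ≠ [] →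
      foldAcc firstOp f x i k [] = f (boolPair x (ones (i + j₀)))
  | _, _, 0, hlt, _, _ => absurd hlt (Nat.not_lt_zero _)
  | 0, i, k + 1, _, _, hne => by
    have hne' : f (boolPair x (ones i)) ≠ [] := by simpa using hne
    rw [foldAcc_succ, firstOp_boolPair, if_pos rfl, foldAcc_firstOp_kept f x k (i + 1) _ hne']
    simp
  | j₀ + 1, i, k + 1, hlt, hzero, hne => by
    have h0 : f (boolPair x (ones i)) = [] := by simpa using hzero 0 (Nat.succ_pos _)
    rw [foldAcc_succ, firstOp_boolPair, if_pos rfl, h0,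
      foldAcc_firstOp f x j₀ (i + 1) k (by omega)
        (fun j hj => by rw [show i + 1 + j = i + (j + 1) by omega]; exact hzero (j + 1) (by omega))
        (by rw [show i + 1 + j₀ = i + (j₀ + 1) by omega]; exact hne),
      show i + 1 + j₀ = i + (j₀ + 1) by omega]

/-- **Step 2**: `rFn U = bin (leastR n L R)` — the first `j ≤ R` with `GoodGe2 n L j`. [cite: AgrawalKayalSaxena2004, §4 (step 2)] -/
noncomputable def rFn : List Bool → List Bool :=
  sndPow 2 ∘ foldLoop firstOp (clipF 1 pieceR) X ∘ fanoutFn id (fanoutFn (lenBinF ∘ Plumb.polyFn rPoly1 ∘ sndF) fun _ => boolPair [] [])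

/-- `rFn` is in `FP` (composition of bricks). [folklore] -/
theorem rFn_mem_FP : rFn ∈ FP :=
  comp_mem_FP (sndPow_mem_FP 2) (comp_mem_FP (foldLoop_clipF_mem_FP 1 firstOp_mem_FP length_firstOp_le pieceR_mem_FP X)
    (fanoutFn_mem_FP OracleCompose.id_mem_FP (fanoutFn_mem_FP
      (comp_mem_FP lenBinF_mem_FP (comp_mem_FP (Plumb.polyFn_mem_FP _) sndF_mem_FP)) (const_mem_FP _))))

/-- `rFn_apply` (auxiliary; see the module docstring). [folklore] -/
theorem rFn_apply {n : ℕ} (hn : 2 ≤ n) : rFn (uOf n) = encodeNat (AKS.leastR n n.size (AKS.rBound n.size)) := by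
  obtain ⟨hr2, hrR, hgood⟩ := AKS.leastR_le_rBound hn (Nat.lt_size_self n)
  have hinit : fanoutFn id (fanoutFn (lenBinF ∘ Plumb.polyFn rPoly1 ∘ sndF) fun _ => boolPair [] []) (uOf n) =
      boolPair (uOf n) (boolPair (encodeNat (AKS.rBound n.size + 1)) (boolPair (ones 0) [])) := by
    rw [show (ones 0 : List Bool) = [] from rfl]
    simp [uOf, TM2Pass.length_encodeNat_eq_size]
  rw [rFn, Function.comp_apply, Function.comp_apply, hinit,
    foldLoop_apply firstOp _ (by rw [eval_X]; exact rBound_succ_le_length_uOf n) 0 [],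
    show sndPow 2 = sndF ∘ sndF ∘ sndF from rfl]
  simp only [Function.comp_apply, sndF_boolPair]
  have hpiece : ∀ j, pieceR (boolPair (uOf n) (ones j)) = if GoodGe2 n n.size j then encodeNat j else [] := pieceR_apply n
  rw [foldAcc_clipF (C := 1) (fun j _ hj => by
      rw [hpiece]
      split_ifs
      · have h1 : (encodeNat j).length ≤ j := by
          rw [TM2Pass.length_encodeNat_eq_size]; exact Nat.size_le.2 Nat.lt_two_pow_self
        have h2 := rBound_succ_le_length_uOf n
        omega
      · simp),
    foldAcc_firstOp pieceR (uOf n) (AKS.leastR n n.size (AKS.rBound n.size)) 0 (AKS.rBound n.size + 1) (by omega)]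
  · rw [zero_add, hpiece, if_pos ⟨hr2, hgood⟩]
  · intro j hj
    rw [zero_add, hpiece, if_neg]
    intro hQ
    exact Nat.find_min (AKS.leastR_exists n n.size (AKS.rBound n.size)) hj (Or.inr hQ)
  · rw [zero_add, hpiece, if_pos ⟨hr2, hgood⟩]
    exact encodeNat_ne_nil_of_pos (by omega)

end AKSMachine

end Literature.Computability.QuantumComplexity
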